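import Literature.Probability.Independence.BerryEsseen
import HarnessLib

/-!
# A model-free Berry–Esseen bound: Kolmogorov distance to the standard normal from a Gaussian-weighted majorant of the
# characteristic-function difference on a window `|θ| < L`

Topic `Literature/Probability/Independence` (continues `BerryEsseenSmoothing.lean` — Durrett's smoothing inequality (3.4.1),
`Durrett2019_eq_3_4_1` — and `BerryEsseen.lean` — the i.i.d. theorem 3.4.17, whose "second phase" is specific to sums of i.i.d. variables).
THIS FILE isolates the second phase as a MODEL-FREE statement usable for any law whose characteristic function is controlled on a window
(lattice statistics of transfer-matrix models, dependent sums, …):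

* §1 the two Gaussian integrals `∫ e^{−θ²/4} dθ = 2√π`, `∫ θ² e^{−θ²/4} dθ = 4√π` on the whole line, and the integrable majorant
  `e^{−θ²/4}(A + Bθ²)`.
* §2 ★★★ `abs_cdf_sub_gaussian_le_of_charFun_majorant`: if `μ` is a probability measure on `ℝ`, `L > 0`, `A, B ≥ 0` and
  `‖φ_μ(θ) − e^{−θ²/2}‖ ≤ |θ|·e^{−θ²/4}·(A + Bθ²)` for all `|θ| < L`, then for every `x`
  `|μ(−∞,x] − 𝒩(−∞,x]| ≤ (2A + 4B)·√π/π + 48/(5πL)`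
  (smoothing inequality with Pólya's kernel at frequency `L`, `λ = 2/5 ≥ sup 𝒩′`).
* §3 ★★ `abs_cdf_sub_gaussian_le_rate`: the RATE form — if along a sequence `μ_n` the majorant holds with `A = a/r_n`, `B = b/r_n` on the
  window `|θ| < δ r_n` (`r_n > 0`), then `sup_x |μ_n(−∞,x] − 𝒩(−∞,x]| ≤ ((2a + 4b)/√π + 48/(5πδ))/r_n` for every `n` — a Berry–Esseen rate
  `O(1/r_n)` from ONE characteristic-function estimate (for the lane's strip statistics `r_n = √n`, and the estimate is the complex-tilt
  analogue of the uniform quadratic expansion of `Literature/Analysis/Asymptotics/UniformQuadraticTiltExpansion.lean`).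

## Sources
R. Durrett, *Probability: Theory and Examples*, 5th ed. (2019) §3.4.4, display (3.4.1) and the proof of Theorem 3.4.17 (the majorant/integration
step, here with a generic majorant); W. Feller, *An Introduction to Probability Theory and its Applications* II, XVI.5 Lemma 2.  The generic-majorant
formulation and its constants are this lineage's (lane «pcv-sawmu», a-p5 g27); nothing is quoted AS PRINTED.
-/

noncomputable section

open MeasureTheory ProbabilityTheory Filter Complex Set
open Literature.Probability.Distributions
open scoped Topology Real ENNReal

namespace Literature.Probability.Independence

/-! ## §1 The Gaussian integrals and the majorant -/

/-- `∫ e^{−θ²/4} dθ = 2√π` on the whole line (Mathlib's `integral_gaussian` with `b = 1/4`). [cite: Durrett2019, proof of Theorem 3.4.17] -/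
theorem integral_exp_neg_sq_div_four : ∫ θ : ℝ, Real.exp (-θ ^ 2 / 4) = 2 * √π := by
  have h := integral_gaussian (1 / 4)
  have e : (fun x : ℝ => Real.exp (-(1 / 4) * x ^ 2)) = fun θ : ℝ => Real.exp (-θ ^ 2 / 4) := by
    funext x; ring_nf
  rw [e] at h
  rw [h, show π / (1 / 4) = 2 ^ 2 * π by ring, Real.sqrt_mul (by norm_num), Real.sqrt_sq (by norm_num)]

/-- `∫ θ² e^{−θ²/4} dθ = 4√π` on the whole line (twice the half-line integral `integral_Ioi_sq_mul_exp_neg_sq_div_four`).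
[cite: Durrett2019, proof of Theorem 3.4.17] -/
theorem integral_sq_mul_exp_neg_sq_div_four : ∫ θ : ℝ, θ ^ 2 * Real.exp (-θ ^ 2 / 4) = 4 * √π := by
  have e : (fun θ : ℝ => θ ^ 2 * Real.exp (-θ ^ 2 / 4)) = fun θ : ℝ => (fun u : ℝ => u ^ 2 * Real.exp (-u ^ 2 / 4)) |θ| := by
    funext θ; simp only [sq_abs]
  rw [e, integral_comp_abs (f := fun u : ℝ => u ^ 2 * Real.exp (-u ^ 2 / 4)), integral_Ioi_sq_mul_exp_neg_sq_div_four]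
  ring

/-- The majorant `e^{−θ²/4}(A + Bθ²)` is integrable. [cite: Durrett2019, proof of Theorem 3.4.17 (lane plumbing)] -/
theorem integrable_exp_mul_affine_sq (A B : ℝ) : Integrable fun θ : ℝ => Real.exp (-θ ^ 2 / 4) * (A + B * θ ^ 2) := by
  have i0 : Integrable (fun θ : ℝ => Real.exp (-θ ^ 2 / 4)) := by
    have h := integrable_exp_neg_mul_sq (b := 1 / 4) (by norm_num)
    refine h.congr (ae_of_all _ fun x => ?_)
    simp only
    ring_nf
  have i2 : Integrable (fun θ : ℝ => θ ^ 2 * Real.exp (-θ ^ 2 / 4)) := by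
    have h := integrable_rpow_mul_exp_neg_mul_sq (b := 1 / 4) (by norm_num) (s := 2) (by norm_num)
    refine h.congr (ae_of_all _ fun x => ?_)
    simp only [Real.rpow_two]
    ring_nf
  have e : (fun θ : ℝ => Real.exp (-θ ^ 2 / 4) * (A + B * θ ^ 2))
      = fun θ : ℝ => A * Real.exp (-θ ^ 2 / 4) + B * (θ ^ 2 * Real.exp (-θ ^ 2 / 4)) := by
    funext θ; ring
  rw [e]
  exact (i0.const_mul A).add (i2.const_mul B)

/-- `∫ e^{−θ²/4}(A + Bθ²) dθ = (2A + 4B)√π`. [cite: Durrett2019, proof of Theorem 3.4.17 (lane plumbing)] -/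
theorem integral_exp_mul_affine_sq (A B : ℝ) :
    ∫ θ : ℝ, Real.exp (-θ ^ 2 / 4) * (A + B * θ ^ 2) = (2 * A + 4 * B) * √π := by
  have i0 : Integrable (fun θ : ℝ => Real.exp (-θ ^ 2 / 4)) := by
    have h := integrable_exp_neg_mul_sq (b := 1 / 4) (by norm_num)
    refine h.congr (ae_of_all _ fun x => ?_)
    simp only
    ring_nf
  have i2 : Integrable (fun θ : ℝ => θ ^ 2 * Real.exp (-θ ^ 2 / 4)) := by
    have h := integrable_rpow_mul_exp_neg_mul_sq (b := 1 / 4) (by norm_num) (s := 2) (by norm_num)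
    refine h.congr (ae_of_all _ fun x => ?_)
    simp only [Real.rpow_two]
    ring_nf
  have e : (fun θ : ℝ => Real.exp (-θ ^ 2 / 4) * (A + B * θ ^ 2))
      = fun θ : ℝ => A * Real.exp (-θ ^ 2 / 4) + B * (θ ^ 2 * Real.exp (-θ ^ 2 / 4)) := by
    funext θ; ring
  rw [e, integral_add (i0.const_mul A) (i2.const_mul B), MeasureTheory.integral_const_mul, MeasureTheory.integral_const_mul,
    integral_exp_neg_sq_div_four, integral_sq_mul_exp_neg_sq_div_four]
  ring

/-! ## §2 ★★★ Kolmogorov distance from a charfun majorant on a window -/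

variable {μ : Measure ℝ}

/-- The smoothing kernel `g(θ) = ω_L(θ)(φ_μ(θ) − e^{−θ²/2})/(iθ)` is dominated by the majorant divided by `|θ|`: under
`‖φ_μ(θ) − e^{−θ²/2}‖ ≤ |θ| e^{−θ²/4}(A + Bθ²)` for `|θ| < L`, `‖g(θ)‖ ≤ e^{−θ²/4}(A + Bθ²)` for ALL `θ` (`ω_L` vanishes off the window and is `≤ 1` on it).
[cite: Durrett2019, proof of Theorem 3.4.17 (lane statement)] -/
theorem norm_smoothingKernel_le_of_charFun_majorant {L A B : ℝ} (hL : 0 < L) (hA : 0 ≤ A) (hB : 0 ≤ B)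
    (hφ : ∀ θ : ℝ, |θ| < L → ‖charFun μ θ - cexp (-((θ : ℂ) ^ 2 / 2))‖ ≤ |θ| * Real.exp (-θ ^ 2 / 4) * (A + B * θ ^ 2)) (θ : ℝ) :
    ‖((max (1 - |θ / L|) 0 : ℝ) : ℂ) * (charFun μ θ - charFun (gaussianReal 0 1) θ) / ((θ : ℂ) * I)‖
      ≤ Real.exp (-θ ^ 2 / 4) * (A + B * θ ^ 2) := by
  have hRHS0 : 0 ≤ Real.exp (-θ ^ 2 / 4) * (A + B * θ ^ 2) := by positivity
  rcases eq_or_ne θ 0 with rfl | hθ0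
  · simpa using hRHS0
  by_cases hθL : L ≤ |θ|
  · rw [triangle_div_eq_zero hL hθL]
    simpa using hRHS0
  have hθL' : |θ| < L := lt_of_not_ge hθL
  have hθa : 0 < |θ| := abs_pos.2 hθ0
  have hω0 : 0 ≤ max (1 - |θ / L|) 0 := le_max_right _ _
  have hω1 : max (1 - |θ / L|) 0 ≤ 1 := triangle_div_le_one L θ
  rw [charFun_gaussianReal_zero_one, norm_div, norm_mul, norm_mul, Complex.norm_real, Complex.norm_real, norm_I, mul_one,
    Real.norm_of_nonneg hω0, Real.norm_eq_abs, div_le_iff₀ hθa]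
  calc max (1 - |θ / L|) 0 * ‖charFun μ θ - cexp (-((θ : ℂ) ^ 2 / 2))‖
      ≤ 1 * (|θ| * Real.exp (-θ ^ 2 / 4) * (A + B * θ ^ 2)) :=
        mul_le_mul hω1 (hφ θ hθL') (norm_nonneg _) zero_le_one
    _ = Real.exp (-θ ^ 2 / 4) * (A + B * θ ^ 2) * |θ| := by ring

/-- ★★★ **BERRY–ESSEEN FROM A CHARACTERISTIC-FUNCTION MAJORANT ON A WINDOW (model-free).**  Let `μ` be a probability measure on `ℝ`, `L > 0`,
`A, B ≥ 0`, and suppose `‖φ_μ(θ) − e^{−θ²/2}‖ ≤ |θ|·e^{−θ²/4}·(A + Bθ²)` for every `|θ| < L`.  Then for every real `x`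
`|μ(−∞,x] − 𝒩(0,1)(−∞,x]| ≤ (2A + 4B)·√π/π + 48/(5πL)`
— Durrett's smoothing inequality (3.4.1) (`Durrett2019_eq_3_4_1`, Pólya kernel of frequency `L`, `λ = 2/5 ≥ sup 𝒩′`) with the kernel dominated by
`e^{−θ²/4}(A + Bθ²)`, whose integral is `(2A + 4B)√π`.  Durrett's Theorem 3.4.17 is the case `A = 0`-type majorant produced by i.i.d. cumulants;
here the source of the majorant is left to the user.
[cite: Durrett2019, §3.4.4 display (3.4.1) and proof of Theorem 3.4.17 (lane statement with a generic majorant); Feller1971, XVI.5 Lemma 2] -/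
theorem abs_cdf_sub_gaussian_le_of_charFun_majorant [IsProbabilityMeasure μ] {L A B : ℝ} (hL : 0 < L) (hA : 0 ≤ A) (hB : 0 ≤ B)
    (hφ : ∀ θ : ℝ, |θ| < L → ‖charFun μ θ - cexp (-((θ : ℂ) ^ 2 / 2))‖ ≤ |θ| * Real.exp (-θ ^ 2 / 4) * (A + B * θ ^ 2)) (x : ℝ) :
    |μ.real (Iic x) - (gaussianReal 0 1).real (Iic x)| ≤ (2 * A + 4 * B) * √π / π + 48 / (5 * π * L) := by
  have hgb := norm_smoothingKernel_le_of_charFun_majorant (μ := μ) hL hA hB hφ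
  have hgm : AEStronglyMeasurable (fun θ : ℝ => ((max (1 - |θ / L|) 0 : ℝ) : ℂ) *
      (charFun μ θ - charFun (gaussianReal 0 1) θ) / ((θ : ℂ) * I)) volume := by
    refine Measurable.aestronglyMeasurable ?_
    exact ((continuous_ofReal.comp (continuous_triangle_div L)).measurable.mul
      (measurable_charFun.sub measurable_charFun)).div (by fun_prop)
  have hgi : Integrable (fun θ : ℝ => ((max (1 - |θ / L|) 0 : ℝ) : ℂ) *
      (charFun μ θ - charFun (gaussianReal 0 1) θ) / ((θ : ℂ) * I)) :=
    Integrable.mono' (integrable_exp_mul_affine_sq A B) hgm (ae_of_all _ hgb)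
  have hK : ∫ θ : ℝ, ‖((max (1 - |θ / L|) 0 : ℝ) : ℂ) *
      (charFun μ θ - charFun (gaussianReal 0 1) θ) / ((θ : ℂ) * I)‖ ≤ (2 * A + 4 * B) * √π := by
    rw [← integral_exp_mul_affine_sq A B]
    exact integral_mono hgi.norm (integrable_exp_mul_affine_sq A B) hgb
  have h341 := Durrett2019_eq_3_4_1 (μ := μ) (ν := gaussianReal 0 1) hL
    (by norm_num : (0 : ℝ) < 2 / 5) abs_gaussianReal_real_Iic_sub_le hgi x
  refine h341.trans ?_
  have hπ := Real.pi_pos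
  calc π⁻¹ * (∫ θ : ℝ, ‖((max (1 - |θ / L|) 0 : ℝ) : ℂ) *
        (charFun μ θ - charFun (gaussianReal 0 1) θ) / ((θ : ℂ) * I)‖) + 24 * (2 / 5) / (π * L)
      ≤ π⁻¹ * ((2 * A + 4 * B) * √π) + 24 * (2 / 5) / (π * L) := by gcongr
    _ = (2 * A + 4 * B) * √π / π + 48 / (5 * π * L) := by
        field_simp
        ring

/-- The same bound for the SUPREMUM over `x` written pointwise with the two terms separated: the "smoothness price" `48/(5πL)` of cutting the
frequencies at `L` and the "majorant price" `(2A + 4B)/√π`. [cite: Durrett2019, §3.4.4 display (3.4.1) (lane corollary)] -/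
theorem abs_cdf_sub_gaussian_le_of_charFun_majorant' [IsProbabilityMeasure μ] {L A B : ℝ} (hL : 0 < L) (hA : 0 ≤ A) (hB : 0 ≤ B)
    (hφ : ∀ θ : ℝ, |θ| < L → ‖charFun μ θ - cexp (-((θ : ℂ) ^ 2 / 2))‖ ≤ |θ| * Real.exp (-θ ^ 2 / 4) * (A + B * θ ^ 2)) (x : ℝ) :
    |μ.real (Iic x) - (gaussianReal 0 1).real (Iic x)| ≤ (2 * A + 4 * B) / √π + 48 / (5 * π * L) := by
  have h := abs_cdf_sub_gaussian_le_of_charFun_majorant hL hA hB hφ x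
  have hπ := Real.pi_pos
  have hsq : 0 < √π := Real.sqrt_pos.2 hπ
  have e : (2 * A + 4 * B) * √π / π = (2 * A + 4 * B) / √π := by
    rw [div_eq_div_iff hπ.ne' hsq.ne']
    linear_combination (2 * A + 4 * B) * Real.mul_self_sqrt hπ.le
  rwa [e] at h

/-! ## §3 ★★ The rate form along a sequence -/

/-- ★★ **BERRY–ESSEEN RATE FROM ONE WINDOWED ESTIMATE.**  Let `μ_n` be probability measures on `ℝ`, `r_n > 0` a rate, `δ > 0`, `a, b ≥ 0`, and suppose
that for every `n` and every `|θ| < δ r_n`: `‖φ_{μ_n}(θ) − e^{−θ²/2}‖ ≤ (|θ| e^{−θ²/4}(a + bθ²))/r_n`.  Then for every `n` and `x`,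
`|μ_n(−∞,x] − 𝒩(0,1)(−∞,x]| ≤ ((2a + 4b)/√π + 48/(5πδ)) / r_n` — the Kolmogorov distance decays at the rate `1/r_n`
(for normalised sums of weakly dependent / Markov-type statistics `r_n = √n`).
[cite: Durrett2019, §3.4.4 Theorem 3.4.17 (lane statement: the rate form with a generic majorant); Feller1971, XVI.5] -/
theorem abs_cdf_sub_gaussian_le_rate {α : Type*} {μs : α → Measure ℝ} [∀ n, IsProbabilityMeasure (μs n)] {r : α → ℝ}
    {δ a b : ℝ} (hδ : 0 < δ) (ha : 0 ≤ a) (hb : 0 ≤ b) (hr : ∀ n, 0 < r n)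
    (hφ : ∀ n, ∀ θ : ℝ, |θ| < δ * r n →
      ‖charFun (μs n) θ - cexp (-((θ : ℂ) ^ 2 / 2))‖ ≤ |θ| * Real.exp (-θ ^ 2 / 4) * (a + b * θ ^ 2) / r n)
    (n : α) (x : ℝ) :
    |(μs n).real (Iic x) - (gaussianReal 0 1).real (Iic x)| ≤ ((2 * a + 4 * b) / √π + 48 / (5 * π * δ)) / r n := by
  have hrn := hr n
  have h := abs_cdf_sub_gaussian_le_of_charFun_majorant' (μ := μs n) (L := δ * r n) (A := a / r n) (B := b / r n)
    (by positivity) (by positivity) (by positivity) (fun θ hθ => by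
      have := hφ n θ hθ
      rw [show |θ| * Real.exp (-θ ^ 2 / 4) * (a / r n + b / r n * θ ^ 2)
        = |θ| * Real.exp (-θ ^ 2 / 4) * (a + b * θ ^ 2) / r n by field_simp]
      exact this) x
  refine h.trans (le_of_eq ?_)
  have hπ := Real.pi_pos
  have hsq : 0 < √π := Real.sqrt_pos.2 hπ
  have e : ((2 * a + 4 * b) / √π + 48 / (5 * π * δ)) / r n = (2 * (a / r n) + 4 * (b / r n)) / √π + 48 / (5 * π * (δ * r n)) := by
    field_simp
  exact e.symm

end Literature.Probability.Independence

end
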